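import Summits.CriticalPhenomena.SAWScalingLimit.Theorems.SAWDevelopingMapHexConjectureKPAnalytic
import HarnessLib

/-!
# Crux `HexConjecture` (stmt-CriticalPhenomena-0808), line `root-locality-replaces-loewner`:
the SCALE-LOCAL analytic step of Krachun–Panagiotis

Landing target:
`Summits/CriticalPhenomena/SAWScalingLimit/Theorems/SAWDevelopingMapHexConjectureKPAnalyticLocal.lean`
(`--supports stmt-CriticalPhenomena-0808`; registered stub `stub_kp_analytic_local`).

Write `a := HV.triDl` (positive, `stub_triDl_pos`; non-increasing, `HV.triDl_antitone`;
`triDl = triDr`, `HV.triDl_eq_triDr`).  The global analytic step `stub_kp_analytic`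
(`…KPAnalytic.lean`) assumes the lower regularity `REG(s) : Σ_{i ≤ s} a i ≤ K·(s+1)·a s` at ALL
scales `s ≥ 1`.  Here REG is assumed only on the window of scales `s` with `T ≤ 4(s+1)` and
`s ≤ 5T`, and the constant `c` of the conclusion `c·a(9T) ≤ W T` depends only on `K, ca, cb` (and
the absolute constant `a 0`), not on `W` or `T`.

Every use of REG in the global proof is at an admissible scale except inside the renewal-sum bound,
which is re-proved locally:
* the LOCAL RATIO LEMMA `(n+1)·a n ≤ K·(m+1)·a m` for `n ≤ m` from REG at the single scale `m`
  (`kpLocal_ratio`, `kpLocal_le_mul`);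
* the reflected sum `Σ_{i ≤ k} a ⌊(k-i-1)/2⌋ = Σ_{l ≤ k} a ⌊(l-1)/2⌋ ≤ a 0 + 2·Σ_{j ≤ s} a j` for
  `k ≤ 2s + 2` (each `j` is hit by at most the two indices `l ∈ {2j+1, 2j+2}`, `kpLocal_sum_half`),
  bounded by REG at `s` and the ratio lemma at `k` (`kpLocal_refl_le`: `≤ 9K²·(k+1)·a k`);
* hence `Σ_{i ≤ k} a i · a ⌊(k-i-1)/2⌋ ≤ 50 K³ (k+1) (a k)²` (`kpLocal_sum_le`) and
  `renCap k ≤ 1600 K³ (k+1)·a k` (`kpLocal_renCap_le`) from REG at `k` and at `s = ⌊(k-1)/2⌋` —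
  both admissible for `k ∈ [T, 5T)`;
* the main theorem then follows the global proof verbatim with the caps
  `M₁ = 1600K³·(2T)·a T`, `M₂ = 1600K³·(5T)·a(4T)`, `K₁ = 2K/a 0 + 3200K³`,
  `K₂ = 5K/a 0 + 8000K³`, `c = min (ca/(2K K₁)) (cb/(4K² K₁ K₂))`.
Sources: Krachun–Panagiotis, arXiv:2310.17299, §3.2 (proof of Proposition 3.1 / Corollary 3.1 from
Lemmas 3.2–3.3); Glazman–Manolescu 2020, Lemma 4.1 (monotonicity of `D^Δ`).
-/

noncomputable section

open Finset
open Literature.Probability.RandomPlanarGeometry.SAW Literature.Probability.RandomPlanarGeometry.SAW.HV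

namespace Summit.CriticalPhenomena.SAWScalingLimit.Theorems.HexConjecture.RootLocality

/-- **The local ratio lemma**: lower regularity `Σ_{i ≤ m} a i ≤ K (m+1) a m` at the single scale
`m` (`a = triDl`, non-increasing) gives `(n+1)·a n ≤ K·(m+1)·a m` for every `n ≤ m` — the first
`n + 1` terms of the sum up to `m` are each at least `a n`.
[cite: KrachunPanagiotis2026, §3.2 (proof of Corollary 3.1)] -/
theorem kpLocal_ratio {K : ℝ} {n m : ℕ}
    (hs : ∑ i ∈ range (m + 1), triDl i ≤ K * ((m : ℝ) + 1) * triDl m) (hnm : n ≤ m) :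
    ((n : ℝ) + 1) * triDl n ≤ K * ((m : ℝ) + 1) * triDl m := by
  calc ((n : ℝ) + 1) * triDl n = ∑ _i ∈ range (n + 1), triDl n := by
        rw [sum_const, card_range, nsmul_eq_mul]; push_cast; ring
    _ ≤ ∑ i ∈ range (n + 1), triDl i :=
        sum_le_sum fun i hi => triDl_antitone (by have := mem_range.1 hi; omega)
    _ ≤ ∑ i ∈ range (m + 1), triDl i :=
        sum_le_sum_of_subset_of_nonneg (range_mono (by omega)) fun i _ _ => triDl_nonneg i
    _ ≤ K * ((m : ℝ) + 1) * triDl m := hs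

/-- The local ratio lemma in quotient-free product form: REG at the scale `m`, `n ≤ m` and
`m + 1 ≤ q·(n + 1)` give `a n ≤ q·K·a m`. [cite: KrachunPanagiotis2026, §3.2 (proof of Corollary 3.1)] -/
theorem kpLocal_le_mul {K : ℝ} {n m : ℕ}
    (hs : ∑ i ∈ range (m + 1), triDl i ≤ K * ((m : ℝ) + 1) * triDl m) (hK0 : 0 ≤ K)
    (hnm : n ≤ m) {q : ℝ} (hq : (m : ℝ) + 1 ≤ q * ((n : ℝ) + 1)) :
    triDl n ≤ q * K * triDl m := by
  have h0 : (0 : ℝ) < (n : ℝ) + 1 := by positivity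
  refine le_of_mul_le_mul_left ?_ h0
  calc ((n : ℝ) + 1) * triDl n ≤ K * ((m : ℝ) + 1) * triDl m := kpLocal_ratio hs hnm
    _ ≤ K * (q * ((n : ℝ) + 1)) * triDl m :=
      mul_le_mul_of_nonneg_right (mul_le_mul_of_nonneg_left hq hK0) (triDl_nonneg m)
    _ = ((n : ℝ) + 1) * (q * K * triDl m) := by ring

/-- **The half-index sum**: `Σ_{l ≤ 2m} a ⌊(l-1)/2⌋ = a 0 + 2·Σ_{j < m} a j` (truncated subtraction:
the index `l = 0` gives `a 0`, and each `j < m` is hit exactly by `l ∈ {2j+1, 2j+2}`). [folklore] -/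
theorem kpLocal_sum_half (m : ℕ) :
    ∑ l ∈ range (2 * m + 1), triDl ((l - 1) / 2) = triDl 0 + 2 * ∑ j ∈ range m, triDl j := by
  induction m with
  | zero => simp
  | succ m ih =>
    have e : 2 * (m + 1) + 1 = 2 * m + 1 + 1 + 1 := by omega
    have e1 : (2 * m + 1 - 1) / 2 = m := by omega
    have e2 : (2 * m + 1 + 1 - 1) / 2 = m := by omega
    rw [e, sum_range_succ, sum_range_succ, ih, sum_range_succ, e1, e2]
    ring

/-- **The reflected renewal sum, locally**: for `s ≤ k ≤ 2s + 2`, REG at the two scales `k` and `s`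
(`K ≥ 1`) gives `Σ_{i ≤ k} a ⌊(k-i-1)/2⌋ ≤ 9K²·(k+1)·a k`: reflect `i ↦ k - i`, use the half-index
sum, REG at `s`, `a s ≤ 4K·a k` (`k + 1 ≤ 4(s+1)`) and `a 0 ≤ K(k+1)·a k`.
[cite: KrachunPanagiotis2026, §3.2 (proof of Corollary 3.1)] -/
theorem kpLocal_refl_le {K : ℝ} (hK1 : 1 ≤ K) {k s : ℕ} (hsk : s ≤ k) (hks : k ≤ 2 * s + 2)
    (hk : ∑ i ∈ range (k + 1), triDl i ≤ K * ((k : ℝ) + 1) * triDl k)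
    (hs : ∑ i ∈ range (s + 1), triDl i ≤ K * ((s : ℝ) + 1) * triDl s) :
    ∑ i ∈ range (k + 1), triDl ((k - i - 1) / 2) ≤ 9 * K ^ 2 * ((k : ℝ) + 1) * triDl k := by
  have hK0 : 0 ≤ K := zero_le_one.trans hK1
  have hre : ∑ i ∈ range (k + 1), triDl ((k - i - 1) / 2) =
      ∑ l ∈ range (k + 1), triDl ((l - 1) / 2) :=
    calc ∑ i ∈ range (k + 1), triDl ((k - i - 1) / 2)
        = ∑ i ∈ range (k + 1), triDl ((k + 1 - 1 - i - 1) / 2) :=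
          sum_congr rfl fun i _ => congrArg triDl (by omega)
      _ = ∑ l ∈ range (k + 1), triDl ((l - 1) / 2) :=
          sum_range_reflect (fun l => triDl ((l - 1) / 2)) (k + 1)
  have h0 : triDl 0 ≤ K * ((k : ℝ) + 1) * triDl k := by
    simpa using kpLocal_ratio hk (Nat.zero_le k)
  have has : triDl s ≤ 4 * K * triDl k :=
    kpLocal_le_mul hk hK0 hsk (by exact_mod_cast (show k + 1 ≤ 4 * (s + 1) by omega))
  have e1 : (s : ℝ) + 1 ≤ (k : ℝ) + 1 := by exact_mod_cast Nat.add_le_add_right hsk 1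
  have hsk' : K * ((s : ℝ) + 1) * triDl s ≤ K * ((k : ℝ) + 1) * (4 * K * triDl k) :=
    mul_le_mul (mul_le_mul_of_nonneg_left e1 hK0) has (triDl_nonneg s)
      (mul_nonneg hK0 (by positivity))
  calc ∑ i ∈ range (k + 1), triDl ((k - i - 1) / 2)
      = ∑ l ∈ range (k + 1), triDl ((l - 1) / 2) := hre
    _ ≤ ∑ l ∈ range (2 * (s + 1) + 1), triDl ((l - 1) / 2) :=
        sum_le_sum_of_subset_of_nonneg (range_mono (by omega)) fun i _ _ => triDl_nonneg _
    _ = triDl 0 + 2 * ∑ j ∈ range (s + 1), triDl j := kpLocal_sum_half (s + 1)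
    _ ≤ K * ((k : ℝ) + 1) * triDl k + 2 * (K * ((s : ℝ) + 1) * triDl s) :=
        add_le_add h0 (mul_le_mul_of_nonneg_left hs zero_le_two)
    _ ≤ K * ((k : ℝ) + 1) * triDl k + 2 * (K * ((k : ℝ) + 1) * (4 * K * triDl k)) :=
        add_le_add le_rfl (mul_le_mul_of_nonneg_left hsk' zero_le_two)
    _ = (K + 8 * K ^ 2) * (((k : ℝ) + 1) * triDl k) := by ring
    _ ≤ 9 * K ^ 2 * (((k : ℝ) + 1) * triDl k) :=
        mul_le_mul_of_nonneg_right (by nlinarith [mul_nonneg hK0 (sub_nonneg.2 hK1)])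
          (mul_nonneg (by positivity) (triDl_nonneg k))
    _ = 9 * K ^ 2 * ((k : ℝ) + 1) * triDl k := by ring

/-- **The renewal sum, locally**: for `s ≤ k ≤ 2s + 2` and REG at the two scales `k`, `s`
(`K ≥ 1`), `Σ_{i ≤ k} a i · a ⌊(k-i-1)/2⌋ ≤ 50 K³ (k+1) (a k)²`.  Termwise
`a i · a j ≤ 5K·a k·(a i + a j)` (one of the two indices is comparable to `k`; REG at `k` only),
then REG at `k` for `Σ a i` and `kpLocal_refl_le` for the reflected sum.
[cite: KrachunPanagiotis2026, §3.2 (proof of Corollary 3.1)] -/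
theorem kpLocal_sum_le {K : ℝ} (hK1 : 1 ≤ K) {k s : ℕ} (hsk : s ≤ k) (hks : k ≤ 2 * s + 2)
    (hk : ∑ i ∈ range (k + 1), triDl i ≤ K * ((k : ℝ) + 1) * triDl k)
    (hs : ∑ i ∈ range (s + 1), triDl i ≤ K * ((s : ℝ) + 1) * triDl s) :
    ∑ i ∈ range (k + 1), triDl i * triDl ((k - i - 1) / 2) ≤
      50 * K ^ 3 * ((k : ℝ) + 1) * triDl k ^ 2 := by
  have hK0 : 0 ≤ K := zero_le_one.trans hK1
  have hak := triDl_nonneg k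
  have h5 : 0 ≤ 5 * K * triDl k := by positivity
  -- termwise: one of the two factors is at most `5K · a k` (REG at the scale `k` only)
  have hterm : ∀ i ∈ range (k + 1), triDl i * triDl ((k - i - 1) / 2) ≤
      5 * K * triDl k * (triDl i + triDl ((k - i - 1) / 2)) := by
    intro i hi
    have hik : i ≤ k := Nat.lt_succ_iff.1 (mem_range.1 hi)
    have hai := triDl_nonneg i
    have haj := triDl_nonneg ((k - i - 1) / 2)
    rcases Nat.lt_or_ge k (2 * i) with h2 | h2
    · -- the first index has `5 (i + 1) ≥ k + 1`
      have hb : triDl i ≤ 5 * K * triDl k :=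
        kpLocal_le_mul hk hK0 hik (by exact_mod_cast (show k + 1 ≤ 5 * (i + 1) by omega))
      calc triDl i * triDl ((k - i - 1) / 2) ≤ 5 * K * triDl k * triDl ((k - i - 1) / 2) :=
            mul_le_mul_of_nonneg_right hb haj
        _ ≤ 5 * K * triDl k * (triDl i + triDl ((k - i - 1) / 2)) :=
            mul_le_mul_of_nonneg_left (le_add_of_nonneg_left hai) h5
    · -- the second index `j = ⌊(k-i-1)/2⌋` has `5 (j + 1) ≥ k + 1`
      have hb : triDl ((k - i - 1) / 2) ≤ 5 * K * triDl k :=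
        kpLocal_le_mul hk hK0 (by omega)
          (by exact_mod_cast (show k + 1 ≤ 5 * ((k - i - 1) / 2 + 1) by omega))
      calc triDl i * triDl ((k - i - 1) / 2) ≤ triDl i * (5 * K * triDl k) :=
            mul_le_mul_of_nonneg_left hb hai
        _ = 5 * K * triDl k * triDl i := mul_comm _ _
        _ ≤ 5 * K * triDl k * (triDl i + triDl ((k - i - 1) / 2)) :=
            mul_le_mul_of_nonneg_left (le_add_of_nonneg_right haj) h5
  have hsum₂ := kpLocal_refl_le hK1 hsk hks hk hs
  calc ∑ i ∈ range (k + 1), triDl i * triDl ((k - i - 1) / 2)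
      ≤ ∑ i ∈ range (k + 1), 5 * K * triDl k * (triDl i + triDl ((k - i - 1) / 2)) :=
        sum_le_sum hterm
    _ = 5 * K * triDl k * (∑ i ∈ range (k + 1), triDl i +
          ∑ i ∈ range (k + 1), triDl ((k - i - 1) / 2)) := by
        rw [← sum_add_distrib, mul_sum]
    _ ≤ 5 * K * triDl k *
          (K * ((k : ℝ) + 1) * triDl k + 9 * K ^ 2 * ((k : ℝ) + 1) * triDl k) :=
        mul_le_mul_of_nonneg_left (add_le_add hk hsum₂) h5
    _ = (5 * K ^ 2 + 45 * K ^ 3) * (((k : ℝ) + 1) * triDl k ^ 2) := by ring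
    _ ≤ 50 * K ^ 3 * (((k : ℝ) + 1) * triDl k ^ 2) :=
        mul_le_mul_of_nonneg_right
          (by nlinarith [mul_nonneg (mul_nonneg hK0 hK0) (sub_nonneg.2 hK1)]) (by positivity)
    _ = 50 * K ^ 3 * ((k : ℝ) + 1) * triDl k ^ 2 := by ring

/-- **KP's renewal cap, locally**: `renCap k = 8·renBound k / triDr k ≤ 1600 K³ (k+1)·a k` from REG
at the two scales `k` and `s` (`s ≤ k ≤ 2s+2`, `K ≥ 1`; `triDr = triDl`, `cos(π/8) ≤ 1`,
`kpLocal_sum_le`). [cite: KrachunPanagiotis2026, §3.2 (M_k and the proof of Corollary 3.1)] -/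
theorem kpLocal_renCap_le {K : ℝ} (hK1 : 1 ≤ K) {k s : ℕ} (hsk : s ≤ k) (hks : k ≤ 2 * s + 2)
    (hk : ∑ i ∈ range (k + 1), triDl i ≤ K * ((k : ℝ) + 1) * triDl k)
    (hs : ∑ i ∈ range (s + 1), triDl i ≤ K * ((s : ℝ) + 1) * triDl s) :
    renCap k ≤ 1600 * K ^ 3 * ((k : ℝ) + 1) * triDl k := by
  have hS := kpLocal_sum_le hK1 hsk hks hk hs
  have hS0 : 0 ≤ ∑ i ∈ range (k + 1), triDl i * triDl ((k - i - 1) / 2) :=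
    sum_nonneg fun i _ => mul_nonneg (triDl_nonneg _) (triDl_nonneg _)
  have hcos1 : Real.cos (Real.pi / 8) ≤ 1 := Real.cos_le_one _
  rw [renCap, ← triDl_eq_triDr, div_le_iff₀ (stub_triDl_pos k), kpAnalytic_renBound_eq]
  nlinarith [triDl_nonneg k, mul_nonneg (sub_nonneg.2 hcos1) hS0]

/-- The local renewal cap on a window: for `S ≤ k`, `k + 1 ≤ q` and REG at `k` and at `s`
(`s ≤ k ≤ 2s+2`), `renCap k ≤ 1600 K³·q·a S` (monotonicity of `a`).
[cite: KrachunPanagiotis2026, §3.2 (M_k)] -/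
theorem kpLocal_renCap_le' {K : ℝ} (hK1 : 1 ≤ K) {S k q s : ℕ} (hSk : S ≤ k) (hkq : k + 1 ≤ q)
    (hsk : s ≤ k) (hks : k ≤ 2 * s + 2)
    (hk : ∑ i ∈ range (k + 1), triDl i ≤ K * ((k : ℝ) + 1) * triDl k)
    (hs : ∑ i ∈ range (s + 1), triDl i ≤ K * ((s : ℝ) + 1) * triDl s) :
    renCap k ≤ 1600 * K ^ 3 * (q : ℝ) * triDl S := by
  have hK0 : 0 ≤ K := zero_le_one.trans hK1
  have e1 : (k : ℝ) + 1 ≤ q := by exact_mod_cast hkq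
  calc renCap k ≤ 1600 * K ^ 3 * ((k : ℝ) + 1) * triDl k := kpLocal_renCap_le hK1 hsk hks hk hs
    _ ≤ 1600 * K ^ 3 * (q : ℝ) * triDl S :=
        mul_le_mul (mul_le_mul_of_nonneg_left e1 (by positivity)) (triDl_antitone hSk)
          (triDl_nonneg k) (by positivity)

/-- **Registered sub-goal `stub_kp_analytic_local`** (crux item stmt-CriticalPhenomena-0808, line
`root-locality-replaces-loewner`): the SCALE-LOCAL analytic step of Krachun–Panagiotis.  For
`K ≥ 1` and `ca, cb > 0` there is `c > 0` (depending on nothing else but `triDl 0`) such that for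
every window mass `W` and every `T ≥ 1`: if the lower regularity
`Σ_{i ≤ s} triDl i ≤ K (s+1) triDl s` holds at the scales `s` with `T ≤ 4(s+1)`, `s ≤ 5T`, and the
two-case recurrence inequality of constructions (a)/(b) holds at `T` for all admissible renewal caps
`M₁` on `[T, 2T)` and `M₂` on `[4T, 5T)`, then `c·triDl(9T) ≤ W T`.  Proof: the caps
`M₁ = 1600K³·(2T)·triDl T`, `M₂ = 1600K³·(5T)·triDl(4T)` are admissible by `kpLocal_renCap_le'`
(REG at `k` and `⌊(k-1)/2⌋` for `k ∈ [T, 5T)`); absorb `1 +` by `triDl 0 ≤ 2T·K·triDl T`,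
`triDl 0 ≤ 5T·K·triDl(4T)` (REG at `T`, `4T`) and cancel with `triDl T ≤ 2K·triDl(2T)`,
`triDl(4T) ≤ 2K·triDl(5T)` (REG at `2T`, `5T`), `triDl(9T) ≤ triDl(5T)`;
`c = min (ca/(2K K₁)) (cb/(4K² K₁ K₂))` with `K₁ = 2K/triDl 0 + 3200K³`, `K₂ = 5K/triDl 0 + 8000K³`.
[cite: KrachunPanagiotis2026, §3.2 (Corollary 3.1 and its proof from Lemmas 3.2–3.3)] -/
theorem stub_kp_analytic_local : ∀ (K ca cb : ℝ), 1 ≤ K → 0 < ca → 0 < cb → ∃ c : ℝ, 0 < c ∧ ∀ (W : ℕ → ℝ) (T : ℕ), 1 ≤ T → (∀ s : ℕ, T ≤ 4 * (s + 1) → s ≤ 5 * T → ∑ i ∈ Finset.range (s + 1), Literature.Probability.RandomPlanarGeometry.SAW.HV.triDl i ≤ K * ((s : ℝ) + 1) * Literature.Probability.RandomPlanarGeometry.SAW.HV.triDl s) → (∀ M₁ M₂ : ℝ, (∀ k : ℕ, T ≤ k → k < 2 * T → renCap k ≤ M₁) → (∀ i : ℕ, 4 * T ≤ i → i < 5 *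 T → renCap i ≤ M₂) → ca * (T : ℝ) * Literature.Probability.RandomPlanarGeometry.SAW.HV.triDl (2 * T) * Literature.Probability.RandomPlanarGeometry.SAW.HV.triDl (5 * T) ≤ (1 + M₁) * W T ∨ cb * (T : ℝ) ^ 2 * Literature.Probability.RandomPlanarGeometry.SAW.HV.triDl (2 * T) * Literature.Probability.RandomPlanarGeometry.SAW.HV.triDl (5 * T) * Literature.Probability.RandomPlanarGeometry.SAW.HV.triDl (9 * T) ≤ (1 + M₁) * (1 + M₂) * W T) → c * Literature.Probability.RandomPlanarGeometry.SAW.HV.triDl (9 * T) ≤ W T := by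
  intro K ca cb hK1 hca hcb
  have hK0 : 0 < K := one_pos.trans_le hK1
  have ha0 : 0 < triDl 0 := stub_triDl_pos 0
  -- the constants absorbing `1 + M₁`, `1 + M₂` (they depend on `K` and `triDl 0` only)
  obtain ⟨K₁, hK₁0, hK₁⟩ : ∃ K₁ : ℝ, 0 < K₁ ∧ K₁ = 2 * K / triDl 0 + 3200 * K ^ 3 :=
    ⟨_, by positivity, rfl⟩
  obtain ⟨K₂, hK₂0, hK₂⟩ : ∃ K₂ : ℝ, 0 < K₂ ∧ K₂ = 5 * K / triDl 0 + 8000 * K ^ 3 :=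
    ⟨_, by positivity, rfl⟩
  refine ⟨min (ca / (2 * K * K₁)) (cb / (4 * K ^ 2 * K₁ * K₂)),
    lt_min (by positivity) (by positivity), fun W T hT hloc hdich => ?_⟩
  have hT0 : (0 : ℝ) < T := by exact_mod_cast hT
  have h2 := stub_triDl_pos (2 * T)
  have h5 := stub_triDl_pos (5 * T)
  -- the caps `M₁ = 1600K³·(2T)·a T`, `M₂ = 1600K³·(5T)·a(4T)` are admissible:
  -- REG is used at `k` and at `⌊(k-1)/2⌋` for `k ∈ [T, 2T) ∪ [4T, 5T)` (admissible scales)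
  have hcap₁ : ∀ k : ℕ, T ≤ k → k < 2 * T →
      renCap k ≤ 1600 * K ^ 3 * ((2 * T : ℕ) : ℝ) * triDl T :=
    fun k hk1 hk2 => kpLocal_renCap_le' hK1 hk1 (by omega) (by omega) (by omega)
      (hloc k (by omega) (by omega)) (hloc ((k - 1) / 2) (by omega) (by omega))
  have hcap₂ : ∀ i : ℕ, 4 * T ≤ i → i < 5 * T →
      renCap i ≤ 1600 * K ^ 3 * ((5 * T : ℕ) : ℝ) * triDl (4 * T) :=
    fun i hi1 hi2 => kpLocal_renCap_le' hK1 hi1 (by omega) (by omega) (by omega)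
      (hloc i (by omega) (by omega)) (hloc ((i - 1) / 2) (by omega) (by omega))
  have hM₁ : (0 : ℝ) ≤ 1 + 1600 * K ^ 3 * ((2 * T : ℕ) : ℝ) * triDl T :=
    add_nonneg zero_le_one (mul_nonneg (by positivity) (triDl_nonneg T))
  have hM₂ : (0 : ℝ) ≤ 1 + 1600 * K ^ 3 * ((5 * T : ℕ) : ℝ) * triDl (4 * T) :=
    add_nonneg zero_le_one (mul_nonneg (by positivity) (triDl_nonneg (4 * T)))
  -- absorbing the `1 +`: `a 0 ≤ 2T·K·a T` (REG at `T`), `a 0 ≤ 5T·K·a(4T)` (REG at `4T`)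
  have e₁ : triDl 0 ≤ 2 * T * K * triDl T :=
    kpLocal_le_mul (hloc T (by omega) (by omega)) hK0.le (Nat.zero_le T)
      (by simpa using (show (T : ℝ) + 1 ≤ 2 * T by exact_mod_cast (show T + 1 ≤ 2 * T by omega)))
  have e₂ : triDl 0 ≤ 5 * T * K * triDl (4 * T) :=
    kpLocal_le_mul (hloc (4 * T) (by omega) (by omega)) hK0.le (Nat.zero_le (4 * T))
      (by simpa using (show ((4 * T : ℕ) : ℝ) + 1 ≤ 5 * T by
        exact_mod_cast (show 4 * T + 1 ≤ 5 * T by omega)))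
  have hone₁ : 1 + 1600 * K ^ 3 * ((2 * T : ℕ) : ℝ) * triDl T ≤ K₁ * T * triDl T := by
    have e : (1 : ℝ) ≤ 2 * T * K * triDl T / triDl 0 := by
      rw [le_div_iff₀ ha0, one_mul]; exact e₁
    have e' : K₁ * T * triDl T =
        2 * T * K * triDl T / triDl 0 + 1600 * K ^ 3 * ((2 * T : ℕ) : ℝ) * triDl T := by
      rw [hK₁]; push_cast; ring
    rw [e']
    exact add_le_add e le_rfl
  have hone₂ : 1 + 1600 * K ^ 3 * ((5 * T : ℕ) : ℝ) * triDl (4 * T) ≤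
      K₂ * T * triDl (4 * T) := by
    have e : (1 : ℝ) ≤ 5 * T * K * triDl (4 * T) / triDl 0 := by
      rw [le_div_iff₀ ha0, one_mul]; exact e₂
    have e' : K₂ * T * triDl (4 * T) = 5 * T * K * triDl (4 * T) / triDl 0 +
        1600 * K ^ 3 * ((5 * T : ℕ) : ℝ) * triDl (4 * T) := by
      rw [hK₂]; push_cast; ring
    rw [e']
    exact add_le_add e le_rfl
  -- ratio facts at the admissible scales `2T` and `5T`, and monotonicity `9T ≥ 5T`
  have r₂ : triDl T ≤ 2 * K * triDl (2 * T) :=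
    kpLocal_le_mul (hloc (2 * T) (by omega) (by omega)) hK0.le (by omega)
      (by exact_mod_cast (show 2 * T + 1 ≤ 2 * (T + 1) by omega))
  have r₅ : triDl (4 * T) ≤ 2 * K * triDl (5 * T) :=
    kpLocal_le_mul (hloc (5 * T) (by omega) (by omega)) hK0.le (by omega)
      (by exact_mod_cast (show 5 * T + 1 ≤ 2 * (4 * T + 1) by omega))
  have m59 : triDl (9 * T) ≤ triDl (5 * T) := triDl_antitone (by omega)
  -- the dichotomy with the chosen caps; in either case `W T > 0`
  have hWT := hdich _ _ hcap₁ hcap₂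
  have hWpos : 0 < W T := by
    rcases hWT with h | h
    · exact pos_of_mul_pos_right ((mul_pos (mul_pos (mul_pos hca hT0) h2) h5).trans_le h) hM₁
    · exact pos_of_mul_pos_right
        ((mul_pos (mul_pos (mul_pos (mul_pos hcb (by positivity)) h2) h5)
          (stub_triDl_pos _)).trans_le h) (mul_nonneg hM₁ hM₂)
  refine kpAnalytic_min_mul_le (triDl_nonneg _) (hWT.imp (fun h => ?_) (fun h => ?_))
  · -- case (a): `ca · a(9T) ≤ 2 K K₁ · W T`
    have key := kpAnalytic_case₁ hT0 h2 m59 hWpos.le (by positivity) hca.le r₂ hone₁ h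
    rw [div_mul_eq_mul_div, div_le_iff₀ (by positivity)]
    exact key.trans_eq (by ring)
  · -- case (b): `cb · a(9T) ≤ 4 K² K₁ K₂ · W T`
    have key := kpAnalytic_case₂ hT0 h2 h5 hWpos.le (by positivity) (by positivity) hM₂
      (triDl_nonneg T) (triDl_nonneg (4 * T)) hK0.le r₂ r₅ hone₁ hone₂ h
    rw [div_mul_eq_mul_div, div_le_iff₀ (by positivity)]
    exact key.trans_eq (by ring)

end Summit.CriticalPhenomena.SAWScalingLimit.Theorems.HexConjecture.RootLocality

end
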